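import Summits.QuantumFields.YangMills.Theses.DirichletWindow
import Literature.MathematicalPhysics.QuantumFieldTheory.CurvatureGaussianField
import HarnessLib

/-!
# `FixedDistanceLower` (item stmt-QuantumFields-8938) reduced to a reflection-positivity transfer from the landed local free-gluon law

Support file for the statement item `stmt-QuantumFields-8938`
(`Summit.QuantumFields.YangMills.Theses.DirichletWindow.FixedDistanceLower`: `f_β(n e₀) ≥ A/(β² n⁸)` for
`n ≥ n₀`, `β ≥ β_n`, uniformly over infinite-volume torus-limit states; with `PlaquetteVarianceUpper` (8939)
and `AxialLogConvexity` (8940, closed) it gives `XiDiverges` (8941) by the landed door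
`xiDivergesOfFixedDistance_proof`).  Seat ym-idea-4 (D-0145 ideator, technique card «spectral / trace
methods»), generation 4, 2026-08-28.  Kernel-checked here, sorry-free: the REDUCTION
`fixedDistanceLower_of : PsdCauchySchwarz → CrossProbeLaw → GaussianRatio → KernelLower → FixedDistanceLower`
to four named, individually provable-now inputs (plain `def … : Prop`, no new notion):

* `PsdCauchySchwarz` — **the lever**: for every torus-limit state the lag-`n` covariance form
  `(a, b) ↦ Cov_μ(a(P₀), b(P_{n e₀}))` on bounded functions of ONE plaquette is a Gram form of the
  Osterwalder–Schrader space (an EVEN power of the transfer operator in the middle: site reflection for odd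
  `n`, link reflection for even `n`, both residues on odd tori — the three cones of
  `DirichletWindowAxialLogConvexityTorus`), hence Cauchy–Schwarz BETWEEN TWO DIFFERENT OBSERVABLES at the
  same lag, `Cov(P₀, ψ(P_n))² ≤ Cov(P₀, P_n)·Cov(ψ(P₀), ψ(P_n))`, plus `0 ≤ f_β(n e₀)`; torus level = tree
  `RPCauchySchwarz.covariance_rp_cauchySchwarz` with `H = P_a`, `K = ψ(P_a)`, limit level as
  `DirichletWindowAxialLogConvexityLimit.tendsto_tcov`;
* `CrossProbeLaw` — the joint local free-gluon law at the two in-line `(0,1)`-plaquettes for the LANDED probe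
  `ψ_β(u) = exp(−2(β(N−u))₊)` of `EquipartitionPinsProbe.stub_localLaw`, with the cross moment against the raw
  plaquette: `β·Cov_μ(P₀, ψ_β(P_n)) → −H_D(n)` and `Cov_μ(ψ_β(P₀), ψ_β(P_n)) → g_D(n)` uniformly over limit
  states (tangent laws (T0) for any finite plaquette family, `EquipartitionPinsProbe.stub_tangent`; rigidity;
  mean equipartition from item 8759 CLOSED; FIRST-moment uniform integrability of `X = β(N − P) ≥ 0` by
  truncation — no second-moment budget);
* `GaussianRatio` — the bivariate-Gaussian computation under `curvatureGaussianField 4 D`: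
  `H_D(n) = −D c_n² 2^{−(D+2)/2}`, `g_D(n) = 2^{−D}((1 − c_n²)^{−D/2} − 1)` (tree
  `GaussianProfile.covariance_formula` pattern), `|c_n| ≤ 1/2`, whence `κ_D c_n² g_D(n) ≤ H_D(n)²` with
  `κ_D = (D/2)(3/4)^{D/2+1}` — asymptotically SHARP: `H²/g → (D/2)c_n²`, the free plaquette two-point function;
* `KernelLower` — axial lower asymptotics of the in-plane lattice-Maxwell plaquette kernel, `|c_n| ≥ κ'/n⁴`
  (`n ≥ n₀`): axial Fourier representation `c_n = −∫_{[−π,π]³}(ε₂+ε₃) r(E)ⁿ/√(E(E+4)) dk/(2π)³ < 0`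
  (`E = ε₁+ε₂+ε₃`, `ε_i = 2(1−cos k_i)`, `r(E) = 1 + E/2 − √(E(E+4))/2`) and Laplace's method,
  `c_n ∼ −1/(π² n⁴)` (Lawler–Limic 2010 §4.3, Uchiyama 1998; tree `latticeGreen_asymptotics` is the
  zeroth-difference case).

Why this is not the recorded plan of 8938 ("chessboard/RP large-field bounds + Markov property + integration
by parts", difficulty L): no large-field or second-moment estimate enters — the transfer from the bounded probe
(whose law IS the landed local free-gluon law) to the raw plaquette is an inequality of the OS inner product,
and the only moment input is `E_μ X → E Q`.  The second-moment budget stays in the deciding crux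
`PlaquetteVarianceUpper` (8939).  HONEST FRAMING: a reduction; the four inputs are open as tree theorems
(each M-sized against landed machinery); 8938/8941 are RECORD-level supports of the dormant summit routes
`DirichletWindow` / `EquipartitionCriticality` (Chatterjee arXiv:1803.01950 Problem 5.1, plaquette channel) —
not a rung of LADDER-YM, not a mass gap, not Clay.  References: [arXiv180301950] §5; [arXiv160201222] §§11–14;
[GarbanSepulveda2023] §§2.3.3, 3.3, 4; [LawlerLimic2010] Thm 4.3.1; [GlimmJaffe1987] §6.
-/

set_option autoImplicit false

noncomputable section

open MeasureTheory
open Literature.MathematicalPhysics.QuantumFieldTheory Literature.MathematicalPhysics.QuantumLattice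
open Literature.Probability.LatticeModels

namespace Summit.QuantumFields.YangMills.Theorems.FixedDistanceLowerPsdTransfer

/-! ### Notation (local definitions; nothing here is a new notion) -/

/-- The axial site `n e₀` of `ℤ⁴` (as in `plaquetteCorrFn … ((n : ℤ) • Pi.single 0 1)`). -/
def axis (n : ℕ) : Site 4 := (n : ℤ) • Pi.single (0 : Fin 4) (1 : ℤ)

/-- The plaquette at `x` in the `(0,1)` coordinate plane, as an index of the curvature Gaussian field. -/
def p01 (x : Site 4) : ZdPlaquette 4 := (x, ⟨((0 : Fin 4), (1 : Fin 4)), Fin.zero_lt_one⟩)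

/-- Truncated correlation `∫ f g − ∫ f ∫ g` (Bochner; the observables used are bounded). -/
def cov {Ω : Type} [MeasurableSpace Ω] (μ : Measure Ω) (f g : Ω → ℝ) : ℝ :=
  (∫ ω, f ω * g ω ∂μ) - (∫ ω, f ω ∂μ) * ∫ ω, g ω ∂μ

/-- The probe profile of the landed local law: `ψ_{β,N}(u) = exp(−2 (β(N − u))₊)`. -/
def psi (β N u : ℝ) : ℝ := Real.exp (-2 * max (β * (N - u)) 0)

variable {G : Type} [Group G] [TopologicalSpace G] [MeasurableSpace G]

/-- The `(0,1)`-plane plaquette observable `Re tr r.ρ(U_{(x;0,1)})`. -/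
def plaq (r : LatticeRep G) (x : Site 4) (U : LGConfig 4 G) : ℝ := plaquetteObs r.ρ x 0 1 U

/-- The probe observable `exp(−2 (β(N − Re tr r.ρ(U_{(x;0,1)})))₊)` at the plaquette `(x; 0,1)`. -/
def probe (β : ℝ) (r : LatticeRep G) (x : Site 4) (U : LGConfig 4 G) : ℝ := psi β r.N (plaq r x U)

/-- The lattice Maxwell field with `D` colours (tree `curvatureGaussianField 4 D`). -/
def nu (D : ℕ) : Measure (ZdPlaquette 4 → Fin D → ℝ) := curvatureGaussianField 4 D

/-- Gaussian plaquette energy `Q_x = ½ Σ_a (Y_{(x;0,1)}^a)²`. -/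
def gQ (D : ℕ) (x : Site 4) (Y : ZdPlaquette 4 → Fin D → ℝ) : ℝ := (1 / 2 : ℝ) * ∑ a : Fin D, (Y (p01 x) a) ^ 2

/-- Gaussian probe `e^{−2 Q_x} = exp(−Σ_a (Y_{(x;0,1)}^a)²)`. -/
def gProbe (D : ℕ) (x : Site 4) (Y : ZdPlaquette 4 → Fin D → ℝ) : ℝ := Real.exp (-(∑ a : Fin D, (Y (p01 x) a) ^ 2))

/-- `H_D(n) = Cov_ν(Q₀, e^{−2Q_{n e₀}})` (a negative number; closed form `−D c_n² 2^{−(D+2)/2}`). -/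
def HG (D n : ℕ) : ℝ := cov (nu D) (gQ D 0) (gProbe D (axis n))

/-- `g_D(n) = Cov_ν(e^{−2Q₀}, e^{−2Q_{n e₀}})` (closed form `2^{−D}((1 − c_n²)^{−D/2} − 1)`). -/
def GG (D n : ℕ) : ℝ := cov (nu D) (gProbe D 0) (gProbe D (axis n))

/-- The in-plane axial lattice-Maxwell plaquette kernel `c_n = E[Y_{(0;0,1)} Y_{(n e₀;0,1)}]`. -/
def kernel01 (n : ℕ) : ℝ := curvatureTwoPoint (p01 0) (p01 (axis n))

/-! ### The four inputs (plain `Prop`s; each provable-now against landed machinery) -/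

/-- INPUT 1 (provable-now, M): **Cauchy–Schwarz in the reflection-positive Gram form at fixed lag**, for
the raw plaquette against any bounded continuous function of the plaquette, in every torus-limit state,
together with `0 ≤ f_β(n e₀)`.  Torus level = tree `RPCauchySchwarz.covariance_rp_cauchySchwarz` with
`H = P_a`, `K = ψ(P_a)` and the three cones of `DirichletWindowAxialLogConvexityTorus` (site / link /
odd-torus mixed reflections); limit level as `DirichletWindowAxialLogConvexityLimit.tendsto_tcov`. -/
def PsdCauchySchwarz : Prop :=
  ∀ (G : Type) [Group G] [TopologicalSpace G] [IsTopologicalGroup G] [CompactSpace G] [MeasurableSpace G]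
    [BorelSpace G], IsCompactSimpleLieGroup G → ∀ r : LatticeRep G,
    ∀ ψ : ℝ → ℝ, Continuous ψ → (∃ C : ℝ, ∀ u, |ψ u| ≤ C) →
    ∀ n : ℕ, 1 ≤ n → ∀ β : ℝ, 0 ≤ β → ∀ μ ∈ infiniteVolumeLimitPoints (d := 4) r.ρ β,
      0 ≤ plaquetteCorrFn r.ρ μ (axis n) ∧
      (cov μ (plaq r 0) (fun U => ψ (plaq r (axis n) U))) ^ 2 ≤
        plaquetteCorrFn r.ρ μ (axis n) * cov μ (fun U => ψ (plaq r 0 U)) (fun U => ψ (plaq r (axis n) U))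

/-- INPUT 2 (provable-now, M/L): **joint local free-gluon law at two in-line plaquettes, with first-moment
uniform integrability** — the `β → ∞` limits, uniform over torus-limit states, of `β·Cov_μ(P₀, ψ_β(P_n))`
(`= −Cov_μ(X₀, e^{−2X_n})`, `X = β(N − P) ≥ 0`) and of the probe autocovariance, are the lattice-Maxwell
numbers `−H_D(n)` and `g_D(n)`.  Inputs, all landed: tangent laws (T0) for ANY finite plaquette family and
bounded continuous test function (`EquipartitionPinsProbe.stub_tangent`), rigidity
(`stub_rigidity` ⇒ `curvatureGaussianField 4 D`), the free-energy log-coefficient (item 8759, giving the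
mean-equipartition hypothesis), and the truncation `X = X ∧ M + (X − M)₊` with
`E(X − M)₊ → E(Q − M)₊` (UI from `X ≥ 0`, `X ⇒ Q`, `E ΣX → E ΣQ`; no symmetry among planes needed:
dominate `X₀` by the sum over the six planes at the origin). -/
def CrossProbeLaw : Prop :=
  ∀ (G : Type) [Group G] [TopologicalSpace G] [IsTopologicalGroup G] [CompactSpace G] [MeasurableSpace G]
    [BorelSpace G], IsCompactSimpleLieGroup G → ∀ r : LatticeRep G,
    ∃ D : ℕ, 0 < D ∧ ∀ (n : ℕ) (ε : ℝ), 0 < ε → ∃ β₁ : ℝ, ∀ β : ℝ, β₁ ≤ β →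
      ∀ μ ∈ infiniteVolumeLimitPoints (d := 4) r.ρ β,
        |β * cov μ (plaq r 0) (probe β r (axis n)) + HG D n| < ε ∧
        |cov μ (probe β r 0) (probe β r (axis n)) - GG D n| < ε

/-- INPUT 3 (provable-now, M): **the Gaussian ratio inequality** — under `curvatureGaussianField 4 D` the
pair `(Y_{p₀}^a, Y_{p_n}^a)_a` is centred Gaussian with covariances `δ_{ab}/2` and `δ_{ab} c_n`
(`covariance_eval_curvatureGaussianField`, `curvatureTwoPoint_self`), whence the closed forms
`H_D(n) = −D c_n² 2^{−(D+2)/2}`, `g_D(n) = 2^{−D}((1 − c_n²)^{−D/2} − 1)` (the second is the tree's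
`GaussianProfile.covariance_formula`) and, since `|c_n| ≤ 1/2` (`GaussianProfile.half_add_nonneg`),
`κ_D c_n² g_D(n) ≤ H_D(n)²` with `κ_D = D (3/4)^{D/2+1} / 2 > 0`; `g_D(n) > 0` whenever `c_n ≠ 0`. -/
def GaussianRatio : Prop :=
  ∀ D : ℕ, 0 < D → ∃ κ : ℝ, 0 < κ ∧ ∀ n : ℕ,
    κ * kernel01 n ^ 2 * GG D n ≤ HG D n ^ 2 ∧ (kernel01 n ≠ 0 → 0 < GG D n)

/-- INPUT 4 (classical, M/L): **axial lower asymptotics of the in-plane lattice-Maxwell plaquette kernel**: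
`|c_n| ≥ κ'/n⁴` for `n ≥ n₀`.  Axial Fourier representation (as the tree's `…AxisFourier` for the
`(1,2)` plane): for `n ≠ 0`, `c_n = −∫_{[−π,π]³} (ε₂+ε₃)(k) r(E(k))ⁿ / √(E(E+4)) dk/(2π)³ < 0` with
`E = ε₁+ε₂+ε₃`, `ε_i = 2(1 − cos k_i)`, `r(E) = 1 + E/2 − √(E(E+4))/2 ∈ (0,1]`; Laplace's method at
`k = 0` gives `c_n ∼ −κ₀/n⁴`, `κ₀ > 0` (continuum: `⟨F₀₁(n e₀)F₀₁(0)⟩ ∝ −1/n⁴`).  Sources: Lawler–Limic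
2010 §4.3 (Green-function asymptotics; tree `latticeGreen_asymptotics` is the zeroth-difference case),
Uchiyama 1998, Garban–Sepúlveda 2023 §3.3. -/
def KernelLower : Prop :=
  ∃ κ' : ℝ, 0 < κ' ∧ ∃ n₀ : ℕ, 1 ≤ n₀ ∧ ∀ n : ℕ, n₀ ≤ n → κ' / (n : ℝ) ^ 4 ≤ |kernel01 n|

/-! ### Elementary facts about the probe profile -/

/-- The probe profile is continuous. [folklore] -/
theorem continuous_psi (β N : ℝ) : Continuous (psi β N) := by
  unfold psi
  fun_prop

/-- The probe profile is bounded by `1`. [folklore] -/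
theorem abs_psi_le (β N u : ℝ) : |psi β N u| ≤ 1 := by
  unfold psi
  rw [abs_of_pos (Real.exp_pos _)]
  apply Real.exp_le_one_iff.2
  have : 0 ≤ max (β * (N - u)) 0 := le_max_right _ _
  linarith

/-! ### The reduction: the four inputs give `FixedDistanceLower` by name -/

/-- **`FixedDistanceLower` from the four inputs** (kernel-checked; the only real-variable content is
`β²u² ≤ β² f v`, `(βu)² ≥ H²/2`, `v ≤ 2g` ⇒ `β² f ≥ H²/(8g) ≥ κ c_n²/8 ≥ κ κ'²/(8 n⁸)`). -/
theorem fixedDistanceLower_of (h1 : PsdCauchySchwarz) (h2 : CrossProbeLaw) (h3 : GaussianRatio)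
    (h4 : KernelLower) : Summit.QuantumFields.YangMills.Theses.DirichletWindow.FixedDistanceLower := by
  intro G _ _ _ _ _ _ hG r
  obtain ⟨D, hD, hlaw⟩ := h2 G hG r
  obtain ⟨κ, hκ, hrat⟩ := h3 D hD
  obtain ⟨κ', hκ', n₀, hn₀, hker⟩ := h4
  refine ⟨κ * κ' ^ 2 / 8, n₀, by positivity, ?_⟩
  intro n hn
  have hn1 : 1 ≤ n := le_trans hn₀ hn
  have hnpos : (0 : ℝ) < n := by exact_mod_cast (show 0 < n by omega)
  have hc : κ' / (n : ℝ) ^ 4 ≤ |kernel01 n| := hker n hn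
  have hcpos : 0 < |kernel01 n| := lt_of_lt_of_le (by positivity) hc
  have hcne : kernel01 n ≠ 0 := abs_pos.mp hcpos
  obtain ⟨hHG, hGGpos⟩ := hrat n
  have hg : 0 < GG D n := hGGpos hcne
  -- `c_n² ≥ κ'²/n⁸`
  have hc2 : κ' ^ 2 / (n : ℝ) ^ 8 ≤ kernel01 n ^ 2 := by
    have h0 : 0 ≤ κ' / (n : ℝ) ^ 4 := by positivity
    have h := mul_le_mul hc hc h0 (abs_nonneg _)
    have hsq : |kernel01 n| * |kernel01 n| = kernel01 n ^ 2 := by rw [← sq, sq_abs]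
    rw [hsq] at h
    have hre : κ' / (n : ℝ) ^ 4 * (κ' / (n : ℝ) ^ 4) = κ' ^ 2 / (n : ℝ) ^ 8 := by
      ring
    rw [hre] at h
    exact h
  -- `H² > 0`
  have hH2 : 0 < HG D n ^ 2 := by
    have : 0 < κ * kernel01 n ^ 2 * GG D n := by
      have hk2 : 0 < kernel01 n ^ 2 := by positivity
      positivity
    exact lt_of_lt_of_le this hHG
  have hHne : HG D n ≠ 0 := by
    intro h0; rw [h0] at hH2; simp at hH2
  -- the tolerance
  set ε : ℝ := min (|HG D n| / 4) (GG D n) with hε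
  have hεpos : 0 < ε := lt_min (by positivity) hg
  have hεH : ε ≤ |HG D n| / 4 := min_le_left _ _
  have hεg : ε ≤ GG D n := min_le_right _ _
  obtain ⟨β₁, hβ₁⟩ := hlaw n ε hεpos
  refine ⟨max β₁ 1, fun β hβ μ hμ => ?_⟩
  have hβ1 : 1 ≤ β := le_trans (le_max_right _ _) hβ
  have hβpos : 0 < β := lt_of_lt_of_le one_pos hβ1
  obtain ⟨hA, hB⟩ := hβ₁ β (le_trans (le_max_left _ _) hβ) μ hμ
  obtain ⟨hf0, hCS⟩ := h1 G hG r (psi β r.N) (continuous_psi β r.N) ⟨1, abs_psi_le β r.N⟩ n hn1 β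
    hβpos.le μ hμ
  show κ * κ' ^ 2 / 8 / (β ^ 2 * (n : ℝ) ^ 8) ≤ plaquetteCorrFn r.ρ μ (axis n)
  have hCS' : (cov μ (plaq r 0) (probe β r (axis n))) ^ 2 ≤
      plaquetteCorrFn r.ρ μ (axis n) * cov μ (probe β r 0) (probe β r (axis n)) := hCS
  -- names
  set f : ℝ := plaquetteCorrFn r.ρ μ (axis n) with hf
  set u : ℝ := cov μ (plaq r 0) (probe β r (axis n)) with hu
  set v : ℝ := cov μ (probe β r 0) (probe β r (axis n)) with hv
  -- from the local law: `(β u)² ≥ H²/2` and `v ≤ 2 g`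
  have hA' : |β * u + HG D n| < |HG D n| / 4 := lt_of_lt_of_le hA hεH
  have hβu2 : HG D n ^ 2 / 4 ≤ (β * u) ^ 2 := by
    by_cases hH : 0 ≤ HG D n
    · rw [abs_of_nonneg hH] at hA'
      obtain ⟨hlo, hhi⟩ := abs_lt.mp hA'
      nlinarith [hlo, hhi, hH]
    · have hH : HG D n < 0 := lt_of_not_ge hH
      rw [abs_of_neg hH] at hA'
      obtain ⟨hlo, hhi⟩ := abs_lt.mp hA'
      nlinarith [hlo, hhi, hH]
  have hv2 : v ≤ 2 * GG D n := by
    have := (abs_sub_lt_iff.mp hB).1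
    linarith
  -- combine: `H²/4 ≤ β² u² ≤ β² f v ≤ β² f (2 g)`
  have hf0' : 0 ≤ f := hf0
  have hkey : HG D n ^ 2 / 4 ≤ β ^ 2 * f * (2 * GG D n) := by
    calc HG D n ^ 2 / 4 ≤ (β * u) ^ 2 := hβu2
      _ = β ^ 2 * u ^ 2 := by ring
      _ ≤ β ^ 2 * (f * v) := by
          exact mul_le_mul_of_nonneg_left hCS' (by positivity)
      _ = β ^ 2 * f * v := by ring
      _ ≤ β ^ 2 * f * (2 * GG D n) := by
          exact mul_le_mul_of_nonneg_left hv2 (by positivity)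
  -- `H² ≥ κ c² g ≥ κ κ'² g / n⁸`
  have hH_lower : κ * (κ' ^ 2 / (n : ℝ) ^ 8) * GG D n ≤ HG D n ^ 2 := by
    calc κ * (κ' ^ 2 / (n : ℝ) ^ 8) * GG D n ≤ κ * kernel01 n ^ 2 * GG D n := by
          have := mul_le_mul_of_nonneg_left hc2 hκ.le
          exact mul_le_mul_of_nonneg_right this hg.le
      _ ≤ HG D n ^ 2 := hHG
  -- conclude `A/(β² n⁸) ≤ f` with `A = κ κ'²/8`
  have hn8 : (0 : ℝ) < (n : ℝ) ^ 8 := by positivity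
  have hβ2 : (0 : ℝ) < β ^ 2 := by positivity
  rw [div_le_iff₀ (by positivity)]
  -- goal: κ * κ'^2 / 8 ≤ f * (β^2 * n^8)
  have h1' : κ * κ' ^ 2 * GG D n ≤ (n : ℝ) ^ 8 * HG D n ^ 2 := by
    have := hH_lower
    rw [show κ * (κ' ^ 2 / (n : ℝ) ^ 8) * GG D n = κ * κ' ^ 2 * GG D n / (n : ℝ) ^ 8 by ring] at this
    rw [div_le_iff₀ hn8] at this
    linarith
  -- `n⁸ H² ≤ n⁸ · 4 · β² f · 2 g`
  have h2' : (n : ℝ) ^ 8 * HG D n ^ 2 ≤ (n : ℝ) ^ 8 * (4 * (β ^ 2 * f * (2 * GG D n))) := by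
    apply mul_le_mul_of_nonneg_left _ hn8.le
    linarith
  have h3' : κ * κ' ^ 2 * GG D n ≤ 8 * GG D n * (f * (β ^ 2 * (n : ℝ) ^ 8)) := by
    calc κ * κ' ^ 2 * GG D n ≤ (n : ℝ) ^ 8 * (4 * (β ^ 2 * f * (2 * GG D n))) := h1'.trans h2'
      _ = 8 * GG D n * (f * (β ^ 2 * (n : ℝ) ^ 8)) := by ring
  -- divide by `8 g > 0`
  have h4' : κ * κ' ^ 2 ≤ 8 * (f * (β ^ 2 * (n : ℝ) ^ 8)) := by
    have := h3'
    nlinarith [hg]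
  linarith

end Summit.QuantumFields.YangMills.Theorems.FixedDistanceLowerPsdTransfer
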